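import Literature.MathematicalPhysics.QuantumLattice.SchwartzTensor
import HarnessLib

/-!
# The external product with a fixed Schwartz function is a continuous linear map

Topic `Analysis/Distribution`; namespace `Literature.Analysis.Distribution`.  Origin: `pub-hodgecm`
MODEL-CONSTRUCTION sub-cell, theta lane (seat mc-theta-3 gen 5), node «W6b-hol (ASM)», item (T-j) "the
junction → carrier dictionary is an intertwiner": the dictionary between the Schwartz model `𝓢(ℝ³)` of the one
non-compact real place and the archimedean carrier `𝓢(K_∞^J) = 𝓢(ℝ^{3g})` of a CM field of degree `2g`, `g ≥ 2`,
is `Φ₁ ↦ Φ₁ ⊗ Φ_cpt` (external product with the fixed vector at the compact places) followed by a linear frame,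
and its CONTINUITY is what transports difference-quotient limits and weak differentiability.  KERNEL
MATHEMATICS ONLY: everything below is proved; no record, no cited hypothesis.

For real normed spaces `D, E₁, E₂`, continuous linear `π₁ : D → E₁`, `π₂ : D → E₂` jointly controlling the
norm (`‖x‖ ≤ C₀ · max ‖π₁ x‖ ‖π₂ x‖` — e.g. the two projections of `E₁ × E₂`, or the two restrictions of
`ι₁ ⊕ ι₂ → E`), and Schwartz functions `f` on `E₁`, `g` on `E₂` with values in `𝕜 = ℝ` or `ℂ`, the tree's
`SchwartzMap.mulComp f g π₁ π₂ h : 𝓢(D, 𝕜)` is `x ↦ f (π₁ x) * g (π₂ x)` (`QuantumLattice/SchwartzTensor`,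
Osterwalder–Schrader's `f ⊗ g` in coordinate-free form).  This file proves that it is CONTINUOUS LINEAR in each
factor separately:

* `SchwartzMap.decay_mul_comp_le_sup` — the Leibniz / chain-rule estimate of `SchwartzMap.decay_mul_comp` made
  UNIFORM in the free factor: `‖x‖^k ‖Dⁿ(f ∘ π₁ · g ∘ π₂)(x)‖ ≤ C(g, π₁, π₂, C₀, k, n) · sup_{s(k,n)} p(f)` with the
  finite index set `s(k,n) = {(k,i), (0,i) : i ≤ n}` (`mulCompIndex`) and an explicit constant (`mulCompConst`);
* **`SchwartzMap.mulCompLeftCLM g π₁ π₂ h : 𝓢(E₁, 𝕜) →L[𝕜] 𝓢(D, 𝕜)`**, `f ↦ mulComp f g π₁ π₂ h` (the external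
  product `f ⊗ g` with `g` FIXED, continuous linear in the LEFT factor `f`; Mathlib's `SchwartzMap.mkCLM`), and
  the mirror **`SchwartzMap.mulCompRightCLM f π₁ π₂ h : 𝓢(E₂, 𝕜) →L[𝕜] 𝓢(D, 𝕜)`**, `g ↦ mulComp f g π₁ π₂ h`
  (`f` fixed, continuous linear in the RIGHT factor) — naming as Mathlib's `SchwartzMap.bilinLeftCLM`: the
  suffix names the FREE variable;
* the two standard instances, each in both variants: **`SchwartzMap.extProdLeftCLM g : 𝓢(E₁, 𝕜) →L[𝕜]
  𝓢(E₁ × E₂, 𝕜)`**, `(extProdLeftCLM g f) (x, y) = f x * g y` (+ `extProdRightCLM f`), and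
  **`SchwartzMap.sumProdLeftCLM g : 𝓢((ι₁ → E), 𝕜) →L[𝕜] 𝓢((ι₁ ⊕ ι₂ → E), 𝕜)`**,
  `(sumProdLeftCLM g f) x = f (x ∘ inl) * g (x ∘ inr)` (+ `sumProdRightCLM f`; the formula of the tree's
  `archBoxTensor` on the archimedean block `(K ⊗ ℝ)^{ι₁ ⊕ ι₂}`).

Relation to the tree (librarian dedup note): the map `mulCompLeftCLM g π₁ π₂ h` is the SAME continuous linear map
as the root-namespace `SchwartzMap.mulCompCLM g π₁ π₂ h` of `Literature/Analysis/FunctionSpaces/WightmanGNSContinuity`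
(built there from `SchwartzMap.decay_mul_comp_le` / `mulCompBound` of `QuantumLattice/SchwingerOSPositivity`); it is
re-derived here, under distinct names and with the uniform estimate spelled out, so that the number-theory cone
(`NumberTheory/Weil1964`, `NumberTheory/Automorphic`) does not import the Wightman / Osterwalder–Schrader files.
A librarian may later re-home both onto this file.

Naming convention (as the sibling `Analysis/Distribution/SchwartzFourierBilinFormCLM`): the declarations are written
`SchwartzMap.<name>` INSIDE `namespace Literature.Analysis.Distribution`, so their fully-qualified names are
`Literature.Analysis.Distribution.SchwartzMap.<name>` (directory-follows-namespace, D-0022); consumers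
`open Literature.Analysis.Distribution` and then write `SchwartzMap.mulCompLeftCLM …` as for a Mathlib extension.

## References (provenance of the estimate; nothing enters as a hypothesis)

* K. Osterwalder, R. Schrader, *Axioms for Euclidean Green's functions*, Comm. Math. Phys. 31 (1973), §2 (test
  functions in separate variables, `f ⊗ g`).
* L. Hörmander, *The Analysis of Linear Partial Differential Operators I*, 2nd ed. (1990), §7.1 (the Schwartz
  space; continuity of bilinear operations via seminorm estimates).
-/

noncomputable section

open scoped SchwartzMap ContDiff

namespace Literature.Analysis.Distribution

variable {𝕜 : Type*} [RCLike 𝕜]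
variable {D E₁ E₂ : Type*} [NormedAddCommGroup D] [NormedSpace ℝ D]
  [NormedAddCommGroup E₁] [NormedSpace ℝ E₁] [NormedAddCommGroup E₂] [NormedSpace ℝ E₂]

/-! ## 1. The uniform Leibniz estimate -/

/-- The finite set of Schwartz seminorm indices of the free factor entering the `(k, n)` decay estimate of an
external product: `{(k, i) : i ≤ n} ∪ {(0, i) : i ≤ n}`. [folklore] -/
def SchwartzMap.mulCompIndex (k n : ℕ) : Finset (ℕ × ℕ) :=
  (Finset.range (n + 1)).image (fun i => (k, i)) ∪ (Finset.range (n + 1)).image (fun i => (0, i))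

/-- the `(k, i)` seminorm of the free factor, `i ≤ n`, is dominated by the sup over `mulCompIndex k n`. [folklore] -/
theorem SchwartzMap.seminorm_le_sup_mulCompIndex (k n : ℕ) {i : ℕ} (hi : i ∈ Finset.range (n + 1))
    (f : 𝓢(E₁, 𝕜)) :
    SchwartzMap.seminorm 𝕜 k i f ≤ (SchwartzMap.mulCompIndex k n).sup (schwartzSeminormFamily 𝕜 E₁ 𝕜) f := by
  have hmem : (k, i) ∈ SchwartzMap.mulCompIndex k n :=
    Finset.mem_union_left _ (Finset.mem_image.2 ⟨i, hi, rfl⟩)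
  have h := Seminorm.le_finset_sup_apply (p := schwartzSeminormFamily 𝕜 E₁ 𝕜) (x := f) hmem
  rwa [SchwartzMap.schwartzSeminormFamily_apply] at h

/-- the `(0, i)` seminorm of the free factor, `i ≤ n`, is dominated by the sup over `mulCompIndex k n`. [folklore] -/
theorem SchwartzMap.seminorm_zero_le_sup_mulCompIndex (k n : ℕ) {i : ℕ} (hi : i ∈ Finset.range (n + 1))
    (f : 𝓢(E₁, 𝕜)) :
    SchwartzMap.seminorm 𝕜 0 i f ≤ (SchwartzMap.mulCompIndex k n).sup (schwartzSeminormFamily 𝕜 E₁ 𝕜) f := by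
  have hmem : (0, i) ∈ SchwartzMap.mulCompIndex k n :=
    Finset.mem_union_right _ (Finset.mem_image.2 ⟨i, hi, rfl⟩)
  have h := Seminorm.le_finset_sup_apply (p := schwartzSeminormFamily 𝕜 E₁ 𝕜) (x := f) hmem
  rwa [SchwartzMap.schwartzSeminormFamily_apply] at h

/-- The explicit constant of the uniform estimate (depends on the fixed factor `g`, the two maps, the control
constant `C₀` and `(k, n)`, NOT on the free factor). [folklore] -/
def SchwartzMap.mulCompConst (g : 𝓢(E₂, 𝕜)) (π₁ : D →L[ℝ] E₁) (π₂ : D →L[ℝ] E₂) (C₀ : ℝ) (k n : ℕ) : ℝ :=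
  |C₀| ^ k * ∑ i ∈ Finset.range (n + 1), (n.choose i : ℝ) * (‖π₁‖ ^ i * ‖π₂‖ ^ (n - i)) *
    (SchwartzMap.seminorm 𝕜 0 (n - i) g + SchwartzMap.seminorm 𝕜 k (n - i) g)

/-- `mulCompConst` is nonnegative. [folklore] -/
theorem SchwartzMap.mulCompConst_nonneg (g : 𝓢(E₂, 𝕜)) (π₁ : D →L[ℝ] E₁) (π₂ : D →L[ℝ] E₂) (C₀ : ℝ)
    (k n : ℕ) : 0 ≤ SchwartzMap.mulCompConst g π₁ π₂ C₀ k n := by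
  unfold SchwartzMap.mulCompConst
  refine mul_nonneg (pow_nonneg (abs_nonneg _) _) (Finset.sum_nonneg fun i _ => ?_)
  exact mul_nonneg (mul_nonneg (Nat.cast_nonneg _) (by positivity))
    (add_nonneg (apply_nonneg _ _) (apply_nonneg _ _))

/-- **The Leibniz / chain-rule estimate for `x ↦ f (π₁ x) * g (π₂ x)`, uniform in `f`**: the `(k, n)` Schwartz
decay quantity is bounded by `mulCompConst g π₁ π₂ C₀ k n` times the sup of the seminorms of `f` over
`mulCompIndex k n` (proof of the tree's `SchwartzMap.decay_mul_comp` with the constant exposed). [folklore] -/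
theorem SchwartzMap.decay_mul_comp_le_sup (g : 𝓢(E₂, 𝕜)) (π₁ : D →L[ℝ] E₁) (π₂ : D →L[ℝ] E₂) {C₀ : ℝ}
    (hC : ∀ x, ‖x‖ ≤ C₀ * max ‖π₁ x‖ ‖π₂ x‖) (k n : ℕ) (f : 𝓢(E₁, 𝕜)) (x : D) :
    ‖x‖ ^ k * ‖iteratedFDeriv ℝ n (fun x => f (π₁ x) * g (π₂ x)) x‖ ≤
      SchwartzMap.mulCompConst g π₁ π₂ C₀ k n *
        (SchwartzMap.mulCompIndex k n).sup (schwartzSeminormFamily 𝕜 E₁ 𝕜) f := by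
  set S : ℝ := (SchwartzMap.mulCompIndex k n).sup (schwartzSeminormFamily 𝕜 E₁ 𝕜) f with hS
  have hS0 : 0 ≤ S := apply_nonneg _ _
  have hf : ContDiff ℝ ∞ (fun x => f (π₁ x)) := (f.smooth ⊤).comp π₁.contDiff
  have hg : ContDiff ℝ ∞ (fun x => g (π₂ x)) := (g.smooth ⊤).comp π₂.contDiff
  have h1 : ∀ i, ‖iteratedFDeriv ℝ i (fun x => f (π₁ x)) x‖ ≤ ‖iteratedFDeriv ℝ i f (π₁ x)‖ * ‖π₁‖ ^ i := by
    intro i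
    rw [show (fun x => f (π₁ x)) = f ∘ π₁ from rfl,
      π₁.iteratedFDeriv_comp_right (f.smooth ⊤) x (i := i) (mod_cast le_top)]
    refine (ContinuousMultilinearMap.norm_compContinuousLinearMap_le _ _).trans ?_
    simp
  have h2 : ∀ i, ‖iteratedFDeriv ℝ i (fun x => g (π₂ x)) x‖ ≤ ‖iteratedFDeriv ℝ i g (π₂ x)‖ * ‖π₂‖ ^ i := by
    intro i
    rw [show (fun x => g (π₂ x)) = g ∘ π₂ from rfl,
      π₂.iteratedFDeriv_comp_right (g.smooth ⊤) x (i := i) (mod_cast le_top)]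
    refine (ContinuousMultilinearMap.norm_compContinuousLinearMap_le _ _).trans ?_
    simp
  have hx : ‖x‖ ^ k ≤ |C₀| ^ k * (‖π₁ x‖ ^ k + ‖π₂ x‖ ^ k) := by
    have h : ‖x‖ ≤ |C₀| * max ‖π₁ x‖ ‖π₂ x‖ :=
      (hC x).trans (mul_le_mul_of_nonneg_right (le_abs_self _) (by positivity))
    have hm : (max ‖π₁ x‖ ‖π₂ x‖) ^ k ≤ ‖π₁ x‖ ^ k + ‖π₂ x‖ ^ k := by
      rcases le_total ‖π₁ x‖ ‖π₂ x‖ with h' | h'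
      · rw [max_eq_right h']; exact le_add_of_nonneg_left (by positivity)
      · rw [max_eq_left h']; exact le_add_of_nonneg_right (by positivity)
    calc ‖x‖ ^ k ≤ (|C₀| * max ‖π₁ x‖ ‖π₂ x‖) ^ k := pow_le_pow_left₀ (norm_nonneg _) h k
      _ = |C₀| ^ k * (max ‖π₁ x‖ ‖π₂ x‖) ^ k := mul_pow _ _ _
      _ ≤ |C₀| ^ k * (‖π₁ x‖ ^ k + ‖π₂ x‖ ^ k) := by gcongr
  -- the four seminorm bounds, the `f`-ones routed through the sup `S`
  have bf₁ : ∀ i ∈ Finset.range (n + 1), ‖π₁ x‖ ^ k * ‖iteratedFDeriv ℝ i f (π₁ x)‖ ≤ S := fun i hi =>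
    (SchwartzMap.le_seminorm 𝕜 k i f _).trans (SchwartzMap.seminorm_le_sup_mulCompIndex k n hi f)
  have bf₂ : ∀ i ∈ Finset.range (n + 1), ‖iteratedFDeriv ℝ i f (π₁ x)‖ ≤ S := fun i hi =>
    (SchwartzMap.norm_iteratedFDeriv_le_seminorm 𝕜 f i _).trans
      (SchwartzMap.seminorm_zero_le_sup_mulCompIndex k n hi f)
  have bg₁ : ∀ i, ‖iteratedFDeriv ℝ i g (π₂ x)‖ ≤ SchwartzMap.seminorm 𝕜 0 i g := fun i =>
    SchwartzMap.norm_iteratedFDeriv_le_seminorm 𝕜 g i _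
  have bg₂ : ∀ i, ‖π₂ x‖ ^ k * ‖iteratedFDeriv ℝ i g (π₂ x)‖ ≤ SchwartzMap.seminorm 𝕜 k i g := fun i =>
    SchwartzMap.le_seminorm 𝕜 k i g _
  calc ‖x‖ ^ k * ‖iteratedFDeriv ℝ n (fun x => f (π₁ x) * g (π₂ x)) x‖
      ≤ (|C₀| ^ k * (‖π₁ x‖ ^ k + ‖π₂ x‖ ^ k)) * ∑ i ∈ Finset.range (n + 1), (n.choose i : ℝ)
          * ‖iteratedFDeriv ℝ i (fun x => f (π₁ x)) x‖
          * ‖iteratedFDeriv ℝ (n - i) (fun x => g (π₂ x)) x‖ := by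
        gcongr
        exact norm_iteratedFDeriv_mul_le hf hg x (mod_cast le_top)
    _ ≤ (|C₀| ^ k * (‖π₁ x‖ ^ k + ‖π₂ x‖ ^ k)) * ∑ i ∈ Finset.range (n + 1), (n.choose i : ℝ)
          * (‖iteratedFDeriv ℝ i f (π₁ x)‖ * ‖π₁‖ ^ i)
          * (‖iteratedFDeriv ℝ (n - i) g (π₂ x)‖ * ‖π₂‖ ^ (n - i)) := by
        gcongr with i hi
        · exact h1 i
        · exact h2 (n - i)
    _ = |C₀| ^ k * ∑ i ∈ Finset.range (n + 1), (n.choose i : ℝ) * (‖π₁‖ ^ i * ‖π₂‖ ^ (n - i)) *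
          ((‖π₁ x‖ ^ k * ‖iteratedFDeriv ℝ i f (π₁ x)‖) * ‖iteratedFDeriv ℝ (n - i) g (π₂ x)‖
            + ‖iteratedFDeriv ℝ i f (π₁ x)‖ * (‖π₂ x‖ ^ k * ‖iteratedFDeriv ℝ (n - i) g (π₂ x)‖)) := by
        rw [mul_assoc, Finset.mul_sum, Finset.mul_sum, Finset.mul_sum]
        refine Finset.sum_congr rfl fun i _ => ?_
        ring
    _ ≤ |C₀| ^ k * ∑ i ∈ Finset.range (n + 1), (n.choose i : ℝ) * (‖π₁‖ ^ i * ‖π₂‖ ^ (n - i)) *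
          (S * SchwartzMap.seminorm 𝕜 0 (n - i) g + S * SchwartzMap.seminorm 𝕜 k (n - i) g) := by
        gcongr with i hi
        · exact bf₁ i hi
        · exact bg₁ _
        · exact bf₂ i hi
        · exact bg₂ _
    _ = SchwartzMap.mulCompConst g π₁ π₂ C₀ k n * S := by
        rw [SchwartzMap.mulCompConst, mul_assoc, Finset.sum_mul]
        refine congrArg _ (Finset.sum_congr rfl fun i _ => ?_)
        ring

/-! ## 2. The continuous linear maps -/

/-- **The external product `f ⊗ g` with `g` FIXED is a continuous linear map of the free LEFT factor `f`**:
`f ↦ (x ↦ f (π₁ x) * g (π₂ x))`, `𝓢(E₁, 𝕜) →L[𝕜] 𝓢(D, 𝕜)` (same map as the root-namespace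
`SchwartzMap.mulCompCLM` of `Analysis/FunctionSpaces/WightmanGNSContinuity`, re-derived for the light import cone;
see the module docstring). [folklore] -/
def SchwartzMap.mulCompLeftCLM (g : 𝓢(E₂, 𝕜)) (π₁ : D →L[ℝ] E₁) (π₂ : D →L[ℝ] E₂)
    (h : ∃ C₀ : ℝ, ∀ x, ‖x‖ ≤ C₀ * max ‖π₁ x‖ ‖π₂ x‖) : 𝓢(E₁, 𝕜) →L[𝕜] 𝓢(D, 𝕜) :=
  SchwartzMap.mkCLM (fun f x => f (π₁ x) * g (π₂ x))
    (fun f f' x => by simp only [add_apply, add_mul])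
    (fun a f x => by simp only [smul_apply, smul_eq_mul, RingHom.id_apply, mul_assoc])
    (fun f => ((f.smooth ⊤).comp π₁.contDiff).mul ((g.smooth ⊤).comp π₂.contDiff))
    (fun m => ⟨SchwartzMap.mulCompIndex m.1 m.2, SchwartzMap.mulCompConst g π₁ π₂ h.choose m.1 m.2,
      SchwartzMap.mulCompConst_nonneg g π₁ π₂ _ m.1 m.2,
      fun f x => SchwartzMap.decay_mul_comp_le_sup g π₁ π₂ h.choose_spec m.1 m.2 f x⟩)

/-- pointwise formula of `mulCompLeftCLM`. [folklore] -/
@[simp] theorem SchwartzMap.mulCompLeftCLM_apply_apply (g : 𝓢(E₂, 𝕜)) (π₁ : D →L[ℝ] E₁) (π₂ : D →L[ℝ] E₂)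
    (h : ∃ C₀ : ℝ, ∀ x, ‖x‖ ≤ C₀ * max ‖π₁ x‖ ‖π₂ x‖) (f : 𝓢(E₁, 𝕜)) (x : D) :
    SchwartzMap.mulCompLeftCLM g π₁ π₂ h f x = f (π₁ x) * g (π₂ x) := rfl

/-- `mulCompLeftCLM g π₁ π₂ h f` IS the tree's `SchwartzMap.mulComp f g π₁ π₂ h`. [folklore] -/
theorem SchwartzMap.mulCompLeftCLM_apply (g : 𝓢(E₂, 𝕜)) (π₁ : D →L[ℝ] E₁) (π₂ : D →L[ℝ] E₂)
    (h : ∃ C₀ : ℝ, ∀ x, ‖x‖ ≤ C₀ * max ‖π₁ x‖ ‖π₂ x‖) (f : 𝓢(E₁, 𝕜)) :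
    SchwartzMap.mulCompLeftCLM g π₁ π₂ h f = SchwartzMap.mulComp f g π₁ π₂ h := rfl

/-- **The external product `f ⊗ g` with `f` FIXED is a continuous linear map of the free RIGHT factor `g`**:
`g ↦ (x ↦ f (π₁ x) * g (π₂ x))`, `𝓢(E₂, 𝕜) →L[𝕜] 𝓢(D, 𝕜)`. [folklore] -/
def SchwartzMap.mulCompRightCLM (f : 𝓢(E₁, 𝕜)) (π₁ : D →L[ℝ] E₁) (π₂ : D →L[ℝ] E₂)
    (h : ∃ C₀ : ℝ, ∀ x, ‖x‖ ≤ C₀ * max ‖π₁ x‖ ‖π₂ x‖) : 𝓢(E₂, 𝕜) →L[𝕜] 𝓢(D, 𝕜) :=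
  SchwartzMap.mkCLM (fun g x => f (π₁ x) * g (π₂ x))
    (fun g g' x => by simp only [add_apply, mul_add])
    (fun a g x => by simp only [smul_apply, smul_eq_mul, RingHom.id_apply, mul_left_comm])
    (fun g => ((f.smooth ⊤).comp π₁.contDiff).mul ((g.smooth ⊤).comp π₂.contDiff))
    (fun m => ⟨SchwartzMap.mulCompIndex m.1 m.2, SchwartzMap.mulCompConst f π₂ π₁ h.choose m.1 m.2,
      SchwartzMap.mulCompConst_nonneg f π₂ π₁ _ m.1 m.2, fun g x => by
        have hC : ∀ x, ‖x‖ ≤ h.choose * max ‖π₂ x‖ ‖π₁ x‖ := fun x => by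
          rw [max_comm]; exact h.choose_spec x
        have e : (fun x => f (π₁ x) * g (π₂ x)) = fun x => g (π₂ x) * f (π₁ x) := funext fun x => mul_comm _ _
        rw [e]
        exact SchwartzMap.decay_mul_comp_le_sup f π₂ π₁ hC m.1 m.2 g x⟩)

/-- pointwise formula of `mulCompRightCLM`. [folklore] -/
@[simp] theorem SchwartzMap.mulCompRightCLM_apply_apply (f : 𝓢(E₁, 𝕜)) (π₁ : D →L[ℝ] E₁)
    (π₂ : D →L[ℝ] E₂) (h : ∃ C₀ : ℝ, ∀ x, ‖x‖ ≤ C₀ * max ‖π₁ x‖ ‖π₂ x‖) (g : 𝓢(E₂, 𝕜)) (x : D) :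
    SchwartzMap.mulCompRightCLM f π₁ π₂ h g x = f (π₁ x) * g (π₂ x) := rfl

/-- `mulCompRightCLM f π₁ π₂ h g` IS the tree's `SchwartzMap.mulComp f g π₁ π₂ h`. [folklore] -/
theorem SchwartzMap.mulCompRightCLM_apply (f : 𝓢(E₁, 𝕜)) (π₁ : D →L[ℝ] E₁) (π₂ : D →L[ℝ] E₂)
    (h : ∃ C₀ : ℝ, ∀ x, ‖x‖ ≤ C₀ * max ‖π₁ x‖ ‖π₂ x‖) (g : 𝓢(E₂, 𝕜)) :
    SchwartzMap.mulCompRightCLM f π₁ π₂ h g = SchwartzMap.mulComp f g π₁ π₂ h := rfl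

/-- the two constructions agree: `mulCompLeftCLM g π₁ π₂ h f = mulCompRightCLM f π₁ π₂ h g`. [folklore] -/
theorem SchwartzMap.mulCompLeftCLM_eq_mulCompRightCLM (f : 𝓢(E₁, 𝕜)) (g : 𝓢(E₂, 𝕜)) (π₁ : D →L[ℝ] E₁)
    (π₂ : D →L[ℝ] E₂) (h : ∃ C₀ : ℝ, ∀ x, ‖x‖ ≤ C₀ * max ‖π₁ x‖ ‖π₂ x‖) :
    SchwartzMap.mulCompLeftCLM g π₁ π₂ h f = SchwartzMap.mulCompRightCLM f π₁ π₂ h g := rfl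

/-! ## 3. The two standard instances -/

/-! ### Products `E₁ × E₂` -/

section Prod

omit [NormedAddCommGroup D] [NormedSpace ℝ D] in
/-- the two projections of a product jointly control the (sup) norm, with constant `1`. [folklore] -/
theorem norm_le_one_mul_max_fst_snd (x : E₁ × E₂) :
    ‖x‖ ≤ 1 * max ‖ContinuousLinearMap.fst ℝ E₁ E₂ x‖ ‖ContinuousLinearMap.snd ℝ E₁ E₂ x‖ := by
  rw [one_mul]; rfl

/-- **The external product `f ⊗ g` on `E₁ × E₂` with `g` fixed, as a continuous linear map of the left factor
`f`**: `(extProdLeftCLM g f) (x, y) = f x * g y`. [folklore] -/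
def SchwartzMap.extProdLeftCLM (g : 𝓢(E₂, 𝕜)) : 𝓢(E₁, 𝕜) →L[𝕜] 𝓢(E₁ × E₂, 𝕜) :=
  SchwartzMap.mulCompLeftCLM g (ContinuousLinearMap.fst ℝ E₁ E₂) (ContinuousLinearMap.snd ℝ E₁ E₂)
    ⟨1, norm_le_one_mul_max_fst_snd⟩

/-- pointwise formula of `extProdLeftCLM`: `(f ⊗ g)(x, y) = f x * g y`. [folklore] -/
@[simp] theorem SchwartzMap.extProdLeftCLM_apply (g : 𝓢(E₂, 𝕜)) (f : 𝓢(E₁, 𝕜)) (x : E₁ × E₂) :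
    SchwartzMap.extProdLeftCLM g f x = f x.1 * g x.2 := rfl

/-- **The external product `f ⊗ g` on `E₁ × E₂` with `f` fixed, as a continuous linear map of the right factor
`g`**: `(extProdRightCLM f g) (x, y) = f x * g y`. [folklore] -/
def SchwartzMap.extProdRightCLM (f : 𝓢(E₁, 𝕜)) : 𝓢(E₂, 𝕜) →L[𝕜] 𝓢(E₁ × E₂, 𝕜) :=
  SchwartzMap.mulCompRightCLM f (ContinuousLinearMap.fst ℝ E₁ E₂) (ContinuousLinearMap.snd ℝ E₁ E₂)
    ⟨1, norm_le_one_mul_max_fst_snd⟩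

/-- pointwise formula of `extProdRightCLM`: `(f ⊗ g)(x, y) = f x * g y`. [folklore] -/
@[simp] theorem SchwartzMap.extProdRightCLM_apply (f : 𝓢(E₁, 𝕜)) (g : 𝓢(E₂, 𝕜)) (x : E₁ × E₂) :
    SchwartzMap.extProdRightCLM f g x = f x.1 * g x.2 := rfl

/-- the two product-space constructions agree. [folklore] -/
theorem SchwartzMap.extProdLeftCLM_eq_extProdRightCLM (f : 𝓢(E₁, 𝕜)) (g : 𝓢(E₂, 𝕜)) :
    SchwartzMap.extProdLeftCLM g f = SchwartzMap.extProdRightCLM f g := rfl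

end Prod

/-! ### Separate variables `ι₁ ⊕ ι₂ → E` -/

section Sum

variable {E : Type*} [NormedAddCommGroup E] [NormedSpace ℝ E] {ι₁ ι₂ : Type*} [Fintype ι₁] [Fintype ι₂]

/-- the two restrictions `x ↦ x ∘ inl`, `x ↦ x ∘ inr` jointly control the sup norm of `ι₁ ⊕ ι₂ → E`, with
constant `1`. [folklore] -/
theorem norm_le_one_mul_max_restrict_inl_inr (x : ι₁ ⊕ ι₂ → E) :
    ‖x‖ ≤ 1 * max ‖SchwartzMap.restrictCLM (E := E) (Sum.inl : ι₁ → ι₁ ⊕ ι₂) x‖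
      ‖SchwartzMap.restrictCLM (E := E) (Sum.inr : ι₂ → ι₁ ⊕ ι₂) x‖ := by
  rw [one_mul, pi_norm_le_iff_of_nonneg (by positivity)]
  rintro (i | j)
  · exact (norm_le_pi_norm (x ∘ Sum.inl) i).trans (le_max_left _ _)
  · exact (norm_le_pi_norm (x ∘ Sum.inr) j).trans (le_max_right _ _)

/-- **The external product `f ⊗ g` in separate variables on `ι₁ ⊕ ι₂ → E` with `g` (the `ι₂`-variables) fixed,
as a continuous linear map of the left factor `f`**: `(sumProdLeftCLM g f) x = f (x ∘ inl) * g (x ∘ inr)` — the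
formula of the tree's `archBoxTensor f g` on the archimedean block. [folklore] -/
def SchwartzMap.sumProdLeftCLM (g : 𝓢((ι₂ → E), 𝕜)) : 𝓢((ι₁ → E), 𝕜) →L[𝕜] 𝓢((ι₁ ⊕ ι₂ → E), 𝕜) :=
  SchwartzMap.mulCompLeftCLM g (SchwartzMap.restrictCLM Sum.inl) (SchwartzMap.restrictCLM Sum.inr)
    ⟨1, norm_le_one_mul_max_restrict_inl_inr⟩

/-- pointwise formula of `sumProdLeftCLM`: `(f ⊗ g)(x) = f (x ∘ inl) * g (x ∘ inr)`. [folklore] -/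
@[simp] theorem SchwartzMap.sumProdLeftCLM_apply (g : 𝓢((ι₂ → E), 𝕜)) (f : 𝓢((ι₁ → E), 𝕜))
    (x : ι₁ ⊕ ι₂ → E) : SchwartzMap.sumProdLeftCLM g f x = f (x ∘ Sum.inl) * g (x ∘ Sum.inr) := rfl

/-- **The external product `f ⊗ g` in separate variables on `ι₁ ⊕ ι₂ → E` with `f` (the `ι₁`-variables) fixed,
as a continuous linear map of the right factor `g`**: `(sumProdRightCLM f g) x = f (x ∘ inl) * g (x ∘ inr)`.
[folklore] -/
def SchwartzMap.sumProdRightCLM (f : 𝓢((ι₁ → E), 𝕜)) : 𝓢((ι₂ → E), 𝕜) →L[𝕜] 𝓢((ι₁ ⊕ ι₂ → E), 𝕜) :=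
  SchwartzMap.mulCompRightCLM f (SchwartzMap.restrictCLM Sum.inl) (SchwartzMap.restrictCLM Sum.inr)
    ⟨1, norm_le_one_mul_max_restrict_inl_inr⟩

/-- pointwise formula of `sumProdRightCLM`: `(f ⊗ g)(x) = f (x ∘ inl) * g (x ∘ inr)`. [folklore] -/
@[simp] theorem SchwartzMap.sumProdRightCLM_apply (f : 𝓢((ι₁ → E), 𝕜)) (g : 𝓢((ι₂ → E), 𝕜))
    (x : ι₁ ⊕ ι₂ → E) : SchwartzMap.sumProdRightCLM f g x = f (x ∘ Sum.inl) * g (x ∘ Sum.inr) := rfl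

/-- the two separate-variables constructions agree. [folklore] -/
theorem SchwartzMap.sumProdLeftCLM_eq_sumProdRightCLM (f : 𝓢((ι₁ → E), 𝕜)) (g : 𝓢((ι₂ → E), 𝕜)) :
    SchwartzMap.sumProdLeftCLM g f = SchwartzMap.sumProdRightCLM f g := rfl

end Sum

end Literature.Analysis.Distribution

end
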